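import Literature.AlgebraicGeometry.Frobenioids.ArchimedeanFSMITests
import Mathlib.RingTheory.RootsOfUnity.Complex
import HarnessLib

/-!
# Frobenioids II, Proposition 3.4 (viii): test arrows of `C₀` at real objects and at isotropic
# complex objects (roots of unity, conjugation, isotropic hulls)

Mochizuki, *The geometry of Frobenioids II: poly-Frobenioids*, Kyushu J. Math. **62** (2008)
401–460, §3, proof of Proposition 3.4 (viii), p. 32 ll. 5–14 [cite: MochizukiFrdII2008, Prop 3.4 (viii) p.32]:
"Suppose that `A`, `B` are real. … one concludes immediately that `φ` is an LB-invertible pre-step, hence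
an isomorphism … If `F₀ = A₀`, then there exists a complex isotropic object `C` of `F₀` and a linear
morphism `C → A`; thus, the existence of torsion elements in `O^×(C)` of arbitrary order … implies [since
`φ` is a monomorphism] that … `φ` is linear, hence an isomorphism. In particular, it follows that every
FSMI-morphism of `F₀` has complex domain and codomain."

This file (abc-iut cell, layer L1, sub-DAG `SUBDAG-FrdII-Prop34.md` row P34-L10, seat abc-iut-w5-d092;
companion of `ArchimedeanFSMITests.lean`) supplies the explicit `C₀`-data behind that paragraph and
behind "no FSMI-morphism goes from a complex to a real object": the lift of an arrow into a real object
along the isotropic hull of its domain (`liftIsotropify`), the rotation `rotHom` / conjugation `conjHom`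
automorphisms of an isotropic complex object and the equations they satisfy (`rotHom_comp`,
`conjHom_comp`), roots of unity (`exists_rootOfUnity`), the complex isotropic object over a real object
with its linear arrow `toRealOf`, and `isIso_of_isRealObj_of_degFr_eq_one` (a linear isometry between
real objects is an isomorphism). [FrdII] §3 is classical and undisputed; no numbered statement of the
paper is restated here.
-/

namespace Literature.AlgebraicGeometry.Frobenioids

open Set Function Topology Real CategoryTheory
open scoped Pointwise

noncomputable section

namespace ArchFrd

namespace C0

variable {P Q X Y : C0}

/-! ### Complex → real: no irreducible arrows -/

/-- An arrow `φ : P → Q` of `C₀` into a REAL object lifts along the isotropic hull `P → P^{iso}` of its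
domain: the same data `(Base φ, deg_Fr φ, c)` out of `P^{iso}` (the base-changed region `A_Q|_L` is
isotropic, so condition (c) only involves the tips). [cite: MochizukiFrdII2008, Prop 3.4 (viii) p.32] -/
def liftIsotropify (φ : P ⟶ Q) (hQ : Q.IsRealObj) : isotropify P ⟶ Q where
  base := @Hom.base P Q φ
  degFr := @Hom.degFr P Q φ
  scalar := @Hom.scalar P Q φ
  scalar_mem := @Hom.scalar_mem P Q φ
  mapsTo := by
    obtain ⟨A, hAc, hAt, -, hAi⟩ := exists_pulledRegion Q (Base φ)
    have hQi : Q.region.IsIsotropic := Q.isIsotropic_of_isReal hQ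
    have hm : scalar φ • P.region.carrier ^ (degFr φ : ℕ) ⊆ A.carrier := by rw [hAc]; exact φ.mapsTo
    change scalar φ • (AngularRegion.isotropicOfTip P.region.tip : AngularRegion ℂ).carrier ^
      (degFr φ : ℕ) ⊆ pullRegion Q (Base φ)
    rw [← hAc]
    rw [← (degFr φ).natPred_add_one] at hm ⊢
    obtain ⟨-, h₂⟩ := (P.region.smul_carrier_pow_subset_iff A (scalar φ) (degFr φ).natPred).1 hm
    refine ((AngularRegion.isotropicOfTip P.region.tip : AngularRegion ℂ).smul_carrier_pow_subset_iff
      A (scalar φ) (degFr φ).natPred).2 ⟨?_, h₂⟩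
    rw [show A.dir = univ from hAi hQi]
    exact subset_univ _

/-- The factorisation `φ = (P → P^{iso}) ≫ liftIsotropify φ`. [cite: MochizukiFrdII2008, Prop 3.4 (viii) p.32] -/
theorem toIsotropic_comp_liftIsotropify (φ : P ⟶ Q) (hQ : Q.IsRealObj) :
    toIsotropic P ≫ liftIsotropify φ hQ = φ := by
  refine hom_ext ?_ ?_ ?_
  · change 𝟙 P.base ≫ @Hom.base P Q φ = @Hom.base P Q φ
    exact Category.id_comp _
  · exact one_mul _
  · change (Base (toIsotropic P)).act (scalar φ) * (1 : ℂˣ) ^ (degFr φ : ℕ) = scalar φ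
    change (D0.Hom.act (𝟙 P.base)) (scalar φ) * (1 : ℂˣ) ^ (degFr φ : ℕ) = scalar φ
    unfold D0.Hom.act
    rw [D0.twists_id, D0.galAct_false, one_pow, mul_one]

/-- An arrow from a complex object to a real object is not an isomorphism (its base is not).
[cite: MochizukiFrdII2008, Ex 3.3 (i) p.27] -/
theorem not_isIso_of_complex_real (ψ : X ⟶ Q) (hX : X.IsComplexObj) (hQ : Q.IsRealObj) : ¬ IsIso ψ := by
  intro h
  haveI hb : IsIso (Base ψ) := (of_isIso ψ).1
  have := D0.eq_of_isIso (C0.Base ψ)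
  exact absurd (hX.symm.trans (this.trans hQ)) (by decide)

/-! ### Automorphisms of isotropic complex objects equalised by an arrow -/

/-- The rotation `(id, 1, ζ)` of a complex (naively) isotropic object by a unit `ζ ∈ O_ℂ^×`.
[cite: MochizukiFrdII2008, Prop 3.4 (viii) p.32] -/
def rotHom (X : C0) (hX : X.IsComplexObj) (hXi : X.region.IsIsotropic) (ζ : ℂˣ) (hζ : ‖(ζ : ℂ)‖ = 1) :
    X ⟶ X where
  base := 𝟙 X.base
  degFr := 1
  scalar := ζ
  scalar_mem := by rw [show X.base = D0.complex from hX, D0.scalars_complex]; trivial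
  mapsTo := by
    rw [PNat.one_coe, pow_one, pullRegion_id]
    rintro _ ⟨u, hu, rfl⟩
    rw [mem_carrier_of_isIsotropic hXi] at hu ⊢
    have : absHom ℂ (ζ • u) = absHom ℂ u := Subtype.ext (by
      rw [coe_absHom, coe_absHom, smul_eq_mul, Units.val_mul, norm_mul, hζ, one_mul])
    rw [this]; exact hu

/-- The conjugation `(conj, 1, s)` of a complex (naively) isotropic object, `s ∈ O_ℂ^×`.
[cite: MochizukiFrdII2008, Prop 3.4 (viii) p.32] -/
def conjHom (X : C0) (hX : X.IsComplexObj) (hXi : X.region.IsIsotropic) (s : ℂˣ) (hs : ‖(s : ℂ)‖ = 1) :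
    X ⟶ X where
  base := eqToHom hX ≫ D0.conj ≫ eqToHom hX.symm
  degFr := 1
  scalar := s
  scalar_mem := by rw [show X.base = D0.complex from hX, D0.scalars_complex]; trivial
  mapsTo := by
    rw [PNat.one_coe, pow_one]
    obtain ⟨A, hAc, hAt, -, hAi⟩ := exists_pulledRegion X (eqToHom hX ≫ D0.conj ≫ eqToHom hX.symm)
    rw [← hAc]
    rintro _ ⟨u, hu, rfl⟩
    rw [mem_carrier_of_isIsotropic hXi] at hu
    rw [mem_carrier_of_isIsotropic (hAi hXi), hAt]
    have : absHom ℂ (s • u) = absHom ℂ u := Subtype.ext (by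
      rw [coe_absHom, coe_absHom, smul_eq_mul, Units.val_mul, norm_mul, hs, one_mul])
    rw [this]; exact hu

/-- A rotation by `ζ ≠ 1` is not the identity. [cite: MochizukiFrdII2008, Prop 3.4 (viii) p.32] -/
theorem rotHom_ne_id (hX : X.IsComplexObj) (hXi : X.region.IsIsotropic) {ζ : ℂˣ} (hζ : ‖(ζ : ℂ)‖ = 1)
    (hζ1 : ζ ≠ 1) : rotHom X hX hXi ζ hζ ≠ 𝟙 X := fun h => hζ1 (congrArg scalar h)

/-- The conjugation is not the identity (its base is `conj`). [cite: MochizukiFrdII2008, Prop 3.4 (viii) p.32] -/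
theorem conjHom_ne_id (hX : X.IsComplexObj) (hXi : X.region.IsIsotropic) {s : ℂˣ} (hs : ‖(s : ℂ)‖ = 1) :
    conjHom X hX hXi s hs ≠ 𝟙 X := by
  intro h
  have hb : D0.Hom.twists (Base (conjHom X hX hXi s hs)) = D0.Hom.twists (Base (𝟙 X)) := by rw [h]
  change D0.Hom.twists (eqToHom hX ≫ D0.conj ≫ eqToHom hX.symm) = _ at hb
  rw [base_id', D0.twists_id, twists_eqToHom_conj hX] at hb
  exact Bool.noConfusion hb

/-- **A non-linear arrow out of an isotropic complex object equalises a nontrivial rotation**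
(roots of unity of order `deg_Fr`): `rotHom ζ ≫ φ = φ` whenever `ζ^{deg_Fr φ} = 1`.
[cite: MochizukiFrdII2008, Prop 3.4 (viii) p.32] -/
theorem rotHom_comp (hX : X.IsComplexObj) (hXi : X.region.IsIsotropic) {ζ : ℂˣ} (hζ : ‖(ζ : ℂ)‖ = 1)
    (φ : X ⟶ Y) (hζd : ζ ^ (degFr φ : ℕ) = 1) : rotHom X hX hXi ζ hζ ≫ φ = φ := by
  refine hom_ext (Category.id_comp _) (one_mul _) ?_
  change (D0.Hom.act (𝟙 X.base)) (scalar φ) * ζ ^ (degFr φ : ℕ) = scalar φ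
  unfold D0.Hom.act
  rw [D0.twists_id, D0.galAct_false, hζd, mul_one]

/-- **An arrow from an isotropic complex object to a REAL object equalises the conjugation** with
`s^{deg_Fr φ} = c/conj(c)`: `conjHom s ≫ φ = φ`. [cite: MochizukiFrdII2008, Prop 3.4 (viii) p.32] -/
theorem conjHom_comp (hX : X.IsComplexObj) (hXi : X.region.IsIsotropic) {s : ℂˣ} (hs : ‖(s : ℂ)‖ = 1)
    (φ : X ⟶ Q) (hQ : Q.IsRealObj) (hsd : star (scalar φ) * s ^ (degFr φ : ℕ) = scalar φ) :
    conjHom X hX hXi s hs ≫ φ = φ := by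
  have hQb : Q.base = D0.real := hQ
  refine hom_ext ?_ (one_mul _) ?_
  · apply D0.hom_to_real_eq hQb
  · change (Base (conjHom X hX hXi s hs)).act (scalar φ) * s ^ (degFr φ : ℕ) = scalar φ
    have htw : D0.Hom.twists (Base (conjHom X hX hXi s hs)) = true :=
      twists_eqToHom_conj hX
    unfold D0.Hom.act
    rw [htw, D0.galAct_true]
    exact hsd

/-- A primitive `d`-th root of unity in `ℂ^×` for `d ≥ 2`: norm `1`, `ζ^d = 1`, `ζ ≠ 1`.
[cite: MochizukiFrdII2008, Prop 3.4 (viii) p.32] -/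
theorem exists_rootOfUnity {d : ℕ} (hd : 2 ≤ d) :
    ∃ ζ : ℂˣ, ‖(ζ : ℂ)‖ = 1 ∧ ζ ^ d = 1 ∧ ζ ≠ 1 := by
  have hd0 : d ≠ 0 := by omega
  have hprim := Complex.isPrimitiveRoot_exp d hd0
  set w : ℂ := Complex.exp (2 * Real.pi * Complex.I / d) with hw
  have hw0 : w ≠ 0 := Complex.exp_ne_zero _
  refine ⟨Units.mk0 w hw0, ?_, ?_, ?_⟩
  · change ‖w‖ = 1
    exact hprim.norm'_eq_one hd0
  · ext; rw [Units.val_pow_eq_pow_val, Units.val_mk0, hprim.pow_eq_one, Units.val_one]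
  · intro h
    have : w = 1 := by rw [← Units.val_mk0 hw0, h, Units.val_one]
    exact hprim.ne_one (by omega) this

/-- A unit `s ∈ O_ℂ^×` with `star c · s = c`, namely `s = c / conj(c)`. [cite: MochizukiFrdII2008, Prop 3.4 (viii) p.32] -/
theorem exists_conj_ratio (c : ℂˣ) : ∃ s : ℂˣ, ‖(s : ℂ)‖ = 1 ∧ star c * s ^ ((1 : ℕ+) : ℕ) = c := by
  refine ⟨c * (star c)⁻¹, ?_, ?_⟩
  · rw [Units.val_mul, Units.val_inv_eq_inv_val, norm_mul, norm_inv]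
    have : ‖((star c : ℂˣ) : ℂ)‖ = ‖(c : ℂ)‖ := by
      change ‖star (c : ℂ)‖ = _; exact norm_star _
    rw [this, mul_inv_cancel₀ (norm_ne_zero_iff.mpr c.ne_zero)]
  · rw [PNat.one_coe, pow_one, mul_comm, inv_mul_cancel_right]

/-! ### Real objects: the complex isotropic object over a real object -/

/-- The complex isotropic object of tip `t`. [cite: MochizukiFrdII2008, Prop 3.4 (viii) p.32] -/
def complexIsotropic (t : PosReal) : C0 where
  base := D0.complex
  region := AngularRegion.isotropicOfTip t
  isIsotropic_of_isReal _ := AngularRegion.isIsotropic_isotropicOfTip _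

/-- `complexIsotropic t` is complex and isotropic. [cite: MochizukiFrdII2008, Prop 3.4 (viii) p.32] -/
theorem complexIsotropic_isComplexObj (t : PosReal) :
    (complexIsotropic t).IsComplexObj ∧ (complexIsotropic t).region.IsIsotropic := ⟨rfl, rfl⟩

/-- "there exists a complex isotropic object `C` of `F₀` and a linear morphism `C → A`" (p. 32 l. 9):
the linear isometry `(Spec ℂ → Spec ℝ, 1, 1)` onto a real object of the same tip.
[cite: MochizukiFrdII2008, Prop 3.4 (viii) p.32] -/
def toRealOf (P : C0) (hP : P.IsRealObj) : complexIsotropic P.region.tip ⟶ P where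
  base := D0.toRealHom ≫ eqToHom hP.symm
  degFr := 1
  scalar := 1
  scalar_mem := by rw [show (complexIsotropic P.region.tip).base = D0.complex from rfl, D0.scalars_complex]; trivial
  mapsTo := by
    rw [one_smul, PNat.one_coe, pow_one]
    obtain ⟨A, hAc, hAt, -, hAi⟩ :=
      exists_pulledRegion P (L := (complexIsotropic P.region.tip).base) (D0.toRealHom ≫ eqToHom hP.symm)
    rw [← hAc]
    intro u hu
    change u ∈ (AngularRegion.isotropicOfTip P.region.tip : AngularRegion ℂ).carrier at hu
    rw [mem_carrier_of_isIsotropic (AngularRegion.isIsotropic_isotropicOfTip _)] at hu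
    rw [mem_carrier_of_isIsotropic (hAi (P.isIsotropic_of_isReal hP)), hAt]
    exact hu

/-- `toRealOf P` is a linear isometry. [cite: MochizukiFrdII2008, Prop 3.4 (viii) p.32] -/
theorem toRealOf_data (hP : P.IsRealObj) :
    degFr (toRealOf P hP) = 1 ∧ scalar (toRealOf P hP) = 1 ∧
      PreFrobenioid.IsIsometry toElem (toRealOf P hP) := by
  refine ⟨rfl, rfl, ?_⟩
  rw [A0.isIsometry_iff_norm_mul_tip_pow]
  change ‖((1 : ℂˣ) : ℂ)‖ * ((complexIsotropic P.region.tip).region.tip : ℝ) ^ ((1 : ℕ+) : ℕ) = P.tip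
  rw [Units.val_one, norm_one, one_mul, PNat.one_coe, pow_one]
  rfl

/-- Rotations change `toRealOf P`: `rotHom ζ ≫ toRealOf P ≠ toRealOf P` for `ζ ≠ 1`.
[cite: MochizukiFrdII2008, Prop 3.4 (viii) p.32] -/
theorem rotHom_comp_toRealOf_ne (hP : P.IsRealObj) {ζ : ℂˣ} (hζ : ‖(ζ : ℂ)‖ = 1) (hζ1 : ζ ≠ 1) :
    rotHom (complexIsotropic P.region.tip) rfl rfl ζ hζ ≫ toRealOf P hP ≠ toRealOf P hP := by
  intro h
  have hs := congrArg scalar h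
  rw [scalar_comp'] at hs
  change (D0.Hom.act (𝟙 D0.complex)) (1 : ℂˣ) * ζ ^ ((1 : ℕ+) : ℕ) = 1 at hs
  rw [map_one, one_mul, PNat.one_coe, pow_one] at hs
  exact hζ1 hs

/-- **A linear isometry between real objects with invertible base is an isomorphism** ("the
LB-invertible base-isomorphism `φ` is linear, hence an isomorphism", p. 32 ll. 12–13; real objects are
isotropic). [cite: MochizukiFrdII2008, Prop 3.4 (viii) p.32] -/
theorem isIso_of_isRealObj_of_degFr_eq_one (φ : P ⟶ Q) (hP : P.IsRealObj) (hQ : Q.IsRealObj)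
    (hlin : degFr φ = 1) (hiso : PreFrobenioid.IsIsometry toElem φ) : IsIso φ := by
  haveI : IsIso (Base φ) := by
    have hPb : P.base = D0.real := hP
    have hQb : Q.base = D0.real := hQ
    revert hPb hQb
    generalize Base φ = f
    revert f
    generalize P.base = K
    generalize Q.base = L
    intro f hK hL; subst hK; subst hL
    rw [D0.hom_real_real_eq_id f]; infer_instance
  exact isIso_of_isIsotropic φ (P.isIsotropic_of_isReal hP) hlin
    ((A0.isIsometry_iff_norm_mul_tip_pow φ).1 hiso)

end C0

end ArchFrd

end

end Literature.AlgebraicGeometry.Frobenioids
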